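import Summits.QuantumFields.YangMills.Theorems.ColdStartUniversalityLatticeLangevinLiebRobinsonThreePointPlaquettes
import HarnessLib

/-!
# Route `ColdStartUniversality` (fixed-cut-off SZZ dynamics; LIEB–ROBINSON / LOCALITY package, file 31):
# ★★★ THE LOOP–PLAQUETTE–PLAQUETTE THIRD CUMULANTS ARE ABSOLUTELY SUMMABLE OVER ALL PAIRS OF PLAQUETTES, UNIFORMLY IN THE VOLUME

Helper file (seat `ym-line-csu-p1`, g31; `--supports stmt-QuantumFields-24809`).  For a non-empty loop word `w` on `(ℤ/L)³` and `μ = μ_(β')`,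
`|β'| < 1/12`:
`Σ_(q,q') |⟨W̃ P̃_q P̃_q'⟩_μ| ≤ 27·B·|w|²·G²`, `B = 4096π²(|w|²+8)(2/ρ)e^(2κ)`, `G = (1 + 24/κ)³/(1 − e^(−κ/4))`, `κ = ρ log 108/(2(λ+ρ))`
(`sum_threePoint_abs_le`) — a bound INDEPENDENT OF `L` although the double sum has `9L⁶` terms.  Mechanism: of the three ways of isolating one
observable from the other two (file 30), the best decays in the MIDDLE one of the three mutual distances `d(w,q), d(w,q'), d(q,q')`
(`le_mul_pairSum_of_three`), and `e^(−κ·middle) ≤ e^(−κ(smallest+middle)/2)` is summable over pairs by the volume-free torus sums of file 19.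
This is the `ℓ¹` input for the second `β`-derivative of Wilson loop expectations (file 32).  THEOREMS ONLY, no definition, no sorry; [folklore].
HONEST FRAMING: fixed cut-off, strong-coupling window; nothing about `β'_K → ∞`; `UniformColdStartMixing` (24809) is NOT restated; no crux,
rung or summit statement is proved; the Yang–Mills mass gap is NOT proved.
-/

set_option autoImplicit false

noncomputable section

namespace Summit.QuantumFields.YangMills.Theorems.ColdStartUniversality.LiebRobinson

open MeasureTheory ProbabilityTheory Matrix Complex Finset Filter Set Metric Function
open scoped ComplexConjugate BigOperators Matrix NNReal ENNReal Topology
open Literature.Probability.Process Literature.MathematicalPhysics.QuantumFieldTheory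
open Literature.MathematicalPhysics.QuantumFieldTheory.Balaban1983to89
open Literature.MathematicalPhysics.QuantumLattice (fundamentalRep fundamentalLatticeRep continuous_fundamentalRep fundamentalRep_apply)

variable {L : ℕ} [NeZero L]

omit [NeZero L] in
/-- **The middle distance wins**: if `t ≤ B e^(−κ·min(dᵢ,dⱼ))` for all three pairs from `d₁, d₂, d₃`, then
`t ≤ B·(e^(−κd₁/2)e^(−κd₂/2) + e^(−κd₁/2)e^(−κd₃/2) + e^(−κd₂/2)e^(−κd₃/2))`. [folklore] -/
theorem le_mul_pairSum_of_three {κ B t : ℝ} (hκ : 0 ≤ κ) (hB : 0 ≤ B) (d₁ d₂ d₃ : ℕ)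
    (h12 : t ≤ B * Real.exp (-(κ * (min d₁ d₂ : ℕ)))) (h13 : t ≤ B * Real.exp (-(κ * (min d₁ d₃ : ℕ))))
    (h23 : t ≤ B * Real.exp (-(κ * (min d₂ d₃ : ℕ)))) :
    t ≤ B * (Real.exp (-(κ / 2 * (d₁ : ℕ))) * Real.exp (-(κ / 2 * (d₂ : ℕ))) + Real.exp (-(κ / 2 * (d₁ : ℕ))) * Real.exp (-(κ / 2 * (d₃ : ℕ))) +
      Real.exp (-(κ / 2 * (d₂ : ℕ))) * Real.exp (-(κ / 2 * (d₃ : ℕ)))) := by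
  have key : ∀ x y : ℕ, y ≤ x → Real.exp (-(κ * (x : ℕ))) ≤ Real.exp (-(κ / 2 * (x : ℕ))) * Real.exp (-(κ / 2 * (y : ℕ))) := by
    intro x y hxy
    rw [← Real.exp_add]
    refine Real.exp_le_exp.2 ?_
    have h : (y : ℝ) ≤ x := by exact_mod_cast hxy
    nlinarith
  have hX : 0 ≤ Real.exp (-(κ / 2 * (d₁ : ℕ))) * Real.exp (-(κ / 2 * (d₂ : ℕ))) := by positivity
  have hY : 0 ≤ Real.exp (-(κ / 2 * (d₁ : ℕ))) * Real.exp (-(κ / 2 * (d₃ : ℕ))) := by positivity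
  have hZ : 0 ≤ Real.exp (-(κ / 2 * (d₂ : ℕ))) * Real.exp (-(κ / 2 * (d₃ : ℕ))) := by positivity
  have fin : ∀ {u : ℝ}, t ≤ B * u → u ≤ Real.exp (-(κ / 2 * (d₁ : ℕ))) * Real.exp (-(κ / 2 * (d₂ : ℕ))) + Real.exp (-(κ / 2 * (d₁ : ℕ))) * Real.exp (-(κ / 2 * (d₃ : ℕ))) +
      Real.exp (-(κ / 2 * (d₂ : ℕ))) * Real.exp (-(κ / 2 * (d₃ : ℕ))) → t ≤ _ := fun hu h => hu.trans (mul_le_mul_of_nonneg_left h hB)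
  rcases le_total d₁ d₂ with h₁₂ | h₂₁ <;> rcases le_total d₁ d₃ with h₁₃ | h₃₁ <;> rcases le_total d₂ d₃ with h₂₃ | h₃₂
  · rw [min_eq_left h₂₃] at h23
    exact fin h23 ((key d₂ d₁ h₁₂).trans (by rw [mul_comm]; linarith))
  · rw [min_eq_right h₃₂] at h23
    exact fin h23 ((key d₃ d₁ h₁₃).trans (by rw [mul_comm]; linarith))
  · rw [min_eq_left h₁₂] at h12
    exact fin h12 ((key d₁ d₃ h₃₁).trans (by linarith))
  · rw [min_eq_left h₁₂] at h12
    exact fin h12 ((key d₁ d₃ h₃₁).trans (by linarith))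
  · rw [min_eq_left h₁₃] at h13
    exact fin h13 ((key d₁ d₂ h₂₁).trans (by linarith))
  · rw [min_eq_left h₁₃] at h13
    exact fin h13 ((key d₁ d₂ h₂₁).trans (by linarith))
  · rw [min_eq_right h₃₁] at h13
    exact fin h13 ((key d₃ d₂ h₂₃).trans (by rw [mul_comm]; linarith))
  · rw [min_eq_right h₂₁] at h12
    exact fin h12 ((key d₂ d₃ h₃₂).trans (by linarith))

/-- ★★★ **ABSOLUTE SUMMABILITY OF THE LOOP–PLAQUETTE–PLAQUETTE THIRD CUMULANTS, UNIFORMLY IN THE VOLUME** (`|β'| < 1/12`, every `L`,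
every non-empty loop word `w`):
`Σ_q Σ_q' |⟨W̃ P̃_q P̃_q'⟩_(μ_β')| ≤ 27·[4096π²(|w|²+8)(2/ρ)e^(2κ)]·|w|²·[(1+24/κ)³/(1−e^(−κ/4))]²`, `κ = ρ log 108/(2(λ+ρ))` — the right-hand side
does not depend on `L`.  Fixed cut-off; the Yang–Mills mass gap is NOT proved. [folklore] -/
theorem sum_threePoint_abs_le (L : ℕ) [NeZero L] (β' : ℝ) (hβ : |β'| < 1 / 12) (l₁ : List (Edge 3 L × Bool)) (hl₁ : l₁ ≠ []) :
    let coords : GaugeConfig 3 L (Matrix.specialUnitaryGroup (Fin 2) ℂ) → (Edge 3 L × Fin 2 × Fin 2 × Bool → ℝ) :=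
      fun V q => (fun z : ℂ => if q.2.2.2 then z.im else z.re)
        ((fundamentalRep (Fin 2) (V q.1) : Matrix (Fin 2) (Fin 2) ℂ) q.2.1 q.2.2.1)
    ∑ q : Plaquette 3 L, ∑ q' : Plaquette 3 L, |∫ x, ((fun y : (Edge 3 L × Fin 2 × Fin 2 × Bool → ℝ) => ((l₁.map (fun a : Edge 3 L × Bool => if a.2 then ((fun (ee : Edge 3 L) => Matrix.of fun (i j : Fin 2) => ((y (ee, i, j, false) : ℝ) : ℂ) + ((y (ee, i, j, true) : ℝ) : ℂ) * Complex.I) a.1)ᴴ else (fun (ee : Edge 3 L) => Matrix.of fun (i j : Fin 2) => ((y (ee, i, j, false) : ℝ) : ℂ) + ((y (ee, i, j, true) : ℝ) : ℂ) * Complex.I) a.1)).prod).trace.re) (coords x) - ∫ x, (fun y : (Edge 3 L × Fin 2 × Fin 2 × Bool → ℝ) => ((l₁.map (fun a : Edge 3 L × Bool => if a.2 then ((fun (ee : Edge 3 L) => Matrix.of fun (i j : Fin 2) => ((y (ee, i, j, false) : ℝ) : ℂ) + ((y (ee, i, j, true) : ℝ) : ℂ) * Complex.I) a.1)ᴴ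 else (fun (ee : Edge 3 L) => Matrix.of fun (i j : Fin 2) => ((y (ee, i, j, false) : ℝ) : ℂ) + ((y (ee, i, j, true) : ℝ) : ℂ) * Complex.I) a.1)).prod).trace.re) (coords x) ∂(wilsonMeasure (d := 3) (L := L) (fundamentalRep (Fin 2)) β')) * ((fun y : (Edge 3 L × Fin 2 × Fin 2 × Bool → ℝ) => (([((q.1, q.2.1.1), false), ((Literature.MathematicalPhysics.QuantumFieldTheory.Site.shift q.1 q.2.1.1, q.2.1.2), false), ((Literature.MathematicalPhysics.QuantumFieldTheory.Site.shift q.1 q.2.1.2, q.2.1.1), true), ((q.1, q.2.1.2), true)].map (fun a : Edge 3 L × Bool => if a.2 then ((fun (ee : Edge 3 L) => Matrix.of fun (i j : Fin 2) => ((y (ee, i, j, false) : ℝ) : ℂ) + ((y (ee, i, j, true) : ℝ) : ℂ) * Complex.I) a.1)ᴴ else (fun (ee : Edge 3 L) => Matrix.of fun (i j : Fin 2) => ((y (ee, i, j, false) : ℝ) : ℂ) + ((y (ee, i, j, true) : ℝ) : ℂ) * Complex.I) a.1)).prod).trace.re) (coords x) - ∫ x, (fun y : (Edge 3 L × Fin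 2 × Fin 2 × Bool → ℝ) => (([((q.1, q.2.1.1), false), ((Literature.MathematicalPhysics.QuantumFieldTheory.Site.shift q.1 q.2.1.1, q.2.1.2), false), ((Literature.MathematicalPhysics.QuantumFieldTheory.Site.shift q.1 q.2.1.2, q.2.1.1), true), ((q.1, q.2.1.2), true)].map (fun a : Edge 3 L × Bool => if a.2 then ((fun (ee : Edge 3 L) => Matrix.of fun (i j : Fin 2) => ((y (ee, i, j, false) : ℝ) : ℂ) + ((y (ee, i, j, true) : ℝ) : ℂ) * Complex.I) a.1)ᴴ else (fun (ee : Edge 3 L) => Matrix.of fun (i j : Fin 2) => ((y (ee, i, j, false) : ℝ) : ℂ) + ((y (ee, i, j, true) : ℝ) : ℂ) * Complex.I) a.1)).prod).trace.re) (coords x) ∂(wilsonMeasure (d := 3) (L := L) (fundamentalRep (Fin 2)) β')) * ((fun y : (Edge 3 L × Fin 2 × Fin 2 × Bool → ℝ) => (([((q'.1, q'.2.1.1), false), ((Literature.MathematicalPhysics.QuantumFieldTheory.Site.shift q'.1 q'.2.1.1, q'.2.1.2), false), ((Literature.MathematicalPhysics.QuantumFieldTheory.Site.shift q'.1 q'.2.1.2,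 q'.2.1.1), true), ((q'.1, q'.2.1.2), true)].map (fun a : Edge 3 L × Bool => if a.2 then ((fun (ee : Edge 3 L) => Matrix.of fun (i j : Fin 2) => ((y (ee, i, j, false) : ℝ) : ℂ) + ((y (ee, i, j, true) : ℝ) : ℂ) * Complex.I) a.1)ᴴ else (fun (ee : Edge 3 L) => Matrix.of fun (i j : Fin 2) => ((y (ee, i, j, false) : ℝ) : ℂ) + ((y (ee, i, j, true) : ℝ) : ℂ) * Complex.I) a.1)).prod).trace.re) (coords x) - ∫ x, (fun y : (Edge 3 L × Fin 2 × Fin 2 × Bool → ℝ) => (([((q'.1, q'.2.1.1), false), ((Literature.MathematicalPhysics.QuantumFieldTheory.Site.shift q'.1 q'.2.1.1, q'.2.1.2), false), ((Literature.MathematicalPhysics.QuantumFieldTheory.Site.shift q'.1 q'.2.1.2, q'.2.1.1), true), ((q'.1, q'.2.1.2), true)].map (fun a : Edge 3 L × Bool => if a.2 then ((fun (ee : Edge 3 L) => Matrix.of fun (i j : Fin 2) => ((y (ee, i, j, false) : ℝ) : ℂ) + ((y (ee, i, j, true) : ℝ) : ℂ) * Complex.I) a.1)ᴴ else (fun (ee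 : Edge 3 L) => Matrix.of fun (i j : Fin 2) => ((y (ee, i, j, false) : ℝ) : ℂ) + ((y (ee, i, j, true) : ℝ) : ℂ) * Complex.I) a.1)).prod).trace.re) (coords x) ∂(wilsonMeasure (d := 3) (L := L) (fundamentalRep (Fin 2)) β')) ∂(wilsonMeasure (d := 3) (L := L) (fundamentalRep (Fin 2)) β')| ≤
      27 * (4096 * Real.pi ^ 2 * ((l₁.length : ℝ) ^ 2 + 8) * (2 / (1 - 12 * |β'|)) * Real.exp (2 * ((1 - 12 * |β'|) * Real.log 108 / (2 * ((1300 + 4 * Real.sqrt 2) * |β'| + (1 - 12 * |β'|)))))) * (l₁.length : ℝ) ^ 2 * ((1 + 12 / (((1 - 12 * |β'|) * Real.log 108 / (2 * ((1300 + 4 * Real.sqrt 2) * |β'| + (1 - 12 * |β'|)))) / 2)) ^ 3 / (1 - Real.exp (-((((1 - 12 * |β'|) * Real.log 108 / (2 * ((1300 + 4 * Real.sqrt 2) * |β'| + (1 - 12 * |β'|)))) / 2) / 2)))) ^ 2 := by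
  intro coords
  classical
  have hlam0 : 0 ≤ (1300 + 4 * Real.sqrt 2) * |β'| := by positivity
  have hrho : 0 < (1 - 12 * |β'|) := by linarith
  have hden : 0 < (1300 + 4 * Real.sqrt 2) * |β'| + (1 - 12 * |β'|) := by linarith
  have hlog : 0 < Real.log 108 := Real.log_pos (by norm_num)
  have hκ : 0 < ((1 - 12 * |β'|) * Real.log 108 / (2 * ((1300 + 4 * Real.sqrt 2) * |β'| + (1 - 12 * |β'|)))) := by positivity
  have hκ2 : 0 < ((1 - 12 * |β'|) * Real.log 108 / (2 * ((1300 + 4 * Real.sqrt 2) * |β'| + (1 - 12 * |β'|)))) / 2 := by positivity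
  have hB0 : 0 ≤ (4096 * Real.pi ^ 2 * ((l₁.length : ℝ) ^ 2 + 8) * (2 / (1 - 12 * |β'|)) * Real.exp (2 * ((1 - 12 * |β'|) * Real.log 108 / (2 * ((1300 + 4 * Real.sqrt 2) * |β'| + (1 - 12 * |β'|)))))) := by positivity
  set S₁ : Finset (Edge 3 L) := (l₁.map Prod.fst).toFinset with hS₁
  have hS₁ne : S₁.Nonempty := by
    rw [hS₁, List.toFinset_nonempty_iff]
    intro h
    exact hl₁ (List.map_eq_nil_iff.1 h)
  have hcardS : (S₁.card : ℝ) ≤ l₁.length := by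
    have h1 := List.toFinset_card_le (l₁.map Prod.fst)
    rw [List.length_map] at h1
    exact_mod_cast h1
  have hGs0 : 0 ≤ ((1 + 12 / (((1 - 12 * |β'|) * Real.log 108 / (2 * ((1300 + 4 * Real.sqrt 2) * |β'| + (1 - 12 * |β'|)))) / 2)) ^ 3 / (1 - Real.exp (-((((1 - 12 * |β'|) * Real.log 108 / (2 * ((1300 + 4 * Real.sqrt 2) * |β'| + (1 - 12 * |β'|)))) / 2) / 2)))) := by
    have h1 : Real.exp (-((((1 - 12 * |β'|) * Real.log 108 / (2 * ((1300 + 4 * Real.sqrt 2) * |β'| + (1 - 12 * |β'|)))) / 2) / 2)) < 1 := Real.exp_lt_one_iff.2 (by linarith)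
    have h2 : 0 < 1 - Real.exp (-((((1 - 12 * |β'|) * Real.log 108 / (2 * ((1300 + 4 * Real.sqrt 2) * |β'| + (1 - 12 * |β'|)))) / 2) / 2)) := by linarith
    positivity
  -- the weights
  set a : Plaquette 3 L → ℝ := fun q => ∑ e' ∈ S₁, Real.exp (-(((1 - 12 * |β'|) * Real.log 108 / (2 * ((1300 + 4 * Real.sqrt 2) * |β'| + (1 - 12 * |β'|)))) / 2 * ((Finset.univ.sup fun i : Fin 3 => ((e'.1 i - q.1 i).valMinAbs).natAbs) : ℕ))) with ha
  set b : Plaquette 3 L → Plaquette 3 L → ℝ := fun q q' => Real.exp (-(((1 - 12 * |β'|) * Real.log 108 / (2 * ((1300 + 4 * Real.sqrt 2) * |β'| + (1 - 12 * |β'|)))) / 2 * ((Finset.univ.sup fun i : Fin 3 => ((q.1 i - q'.1 i).valMinAbs).natAbs) : ℕ))) with hb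
  have ha0 : ∀ q, 0 ≤ a q := fun q => Finset.sum_nonneg fun e' _ => (Real.exp_pos _).le
  have hb0 : ∀ q q', 0 ≤ b q q' := fun q q' => (Real.exp_pos _).le
  have hplanes : (Fintype.card {q : Fin 3 × Fin 3 // q.1 < q.2} : ℝ) = 3 := by norm_cast
  -- (i) volume-free sums of the weights
  have hsiteW : ∀ e' : Edge 3 L, ∑ q : Plaquette 3 L, Real.exp (-(((1 - 12 * |β'|) * Real.log 108 / (2 * ((1300 + 4 * Real.sqrt 2) * |β'| + (1 - 12 * |β'|)))) / 2 * ((Finset.univ.sup fun i : Fin 3 => ((e'.1 i - q.1 i).valMinAbs).natAbs) : ℕ))) ≤ 3 * ((1 + 12 / (((1 - 12 * |β'|) * Real.log 108 / (2 * ((1300 + 4 * Real.sqrt 2) * |β'| + (1 - 12 * |β'|)))) / 2)) ^ 3 / (1 - Real.exp (-((((1 - 12 * |β'|) * Real.log 108 / (2 * ((1300 + 4 * Real.sqrt 2) * |β'| + (1 - 12 * |β'|)))) / 2) / 2)))) := by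
    intro e'
    rw [Fintype.sum_prod_type]
    simp only [Finset.sum_const, Finset.card_univ, nsmul_eq_mul]
    rw [← Finset.mul_sum, hplanes]
    refine mul_le_mul_of_nonneg_left ?_ (by norm_num)
    have h := sum_exp_neg_mul_torusDist_le (L := L) e'.1 hκ2
    refine le_trans (le_of_eq (Finset.sum_congr rfl fun y _ => ?_)) h
    rw [torusDist_comm]
  have hsuma : ∑ q : Plaquette 3 L, a q ≤ (l₁.length : ℝ) * (3 * ((1 + 12 / (((1 - 12 * |β'|) * Real.log 108 / (2 * ((1300 + 4 * Real.sqrt 2) * |β'| + (1 - 12 * |β'|)))) / 2)) ^ 3 / (1 - Real.exp (-((((1 - 12 * |β'|) * Real.log 108 / (2 * ((1300 + 4 * Real.sqrt 2) * |β'| + (1 - 12 * |β'|)))) / 2) / 2))))) := by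
    simp only [ha]
    rw [Finset.sum_comm]
    calc ∑ e' ∈ S₁, ∑ q : Plaquette 3 L, Real.exp (-(((1 - 12 * |β'|) * Real.log 108 / (2 * ((1300 + 4 * Real.sqrt 2) * |β'| + (1 - 12 * |β'|)))) / 2 * ((Finset.univ.sup fun i : Fin 3 => ((e'.1 i - q.1 i).valMinAbs).natAbs) : ℕ))) ≤ ∑ e' ∈ S₁, 3 * ((1 + 12 / (((1 - 12 * |β'|) * Real.log 108 / (2 * ((1300 + 4 * Real.sqrt 2) * |β'| + (1 - 12 * |β'|)))) / 2)) ^ 3 / (1 - Real.exp (-((((1 - 12 * |β'|) * Real.log 108 / (2 * ((1300 + 4 * Real.sqrt 2) * |β'| + (1 - 12 * |β'|)))) / 2) / 2)))) :=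
          Finset.sum_le_sum fun e' _ => hsiteW e'
      _ = (S₁.card : ℝ) * (3 * ((1 + 12 / (((1 - 12 * |β'|) * Real.log 108 / (2 * ((1300 + 4 * Real.sqrt 2) * |β'| + (1 - 12 * |β'|)))) / 2)) ^ 3 / (1 - Real.exp (-((((1 - 12 * |β'|) * Real.log 108 / (2 * ((1300 + 4 * Real.sqrt 2) * |β'| + (1 - 12 * |β'|)))) / 2) / 2))))) := by rw [Finset.sum_const, nsmul_eq_mul]
      _ ≤ (l₁.length : ℝ) * (3 * ((1 + 12 / (((1 - 12 * |β'|) * Real.log 108 / (2 * ((1300 + 4 * Real.sqrt 2) * |β'| + (1 - 12 * |β'|)))) / 2)) ^ 3 / (1 - Real.exp (-((((1 - 12 * |β'|) * Real.log 108 / (2 * ((1300 + 4 * Real.sqrt 2) * |β'| + (1 - 12 * |β'|)))) / 2) / 2))))) := mul_le_mul_of_nonneg_right hcardS (by positivity)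
  have hsumb1 : ∀ q : Plaquette 3 L, ∑ q' : Plaquette 3 L, b q q' ≤ 3 * ((1 + 12 / (((1 - 12 * |β'|) * Real.log 108 / (2 * ((1300 + 4 * Real.sqrt 2) * |β'| + (1 - 12 * |β'|)))) / 2)) ^ 3 / (1 - Real.exp (-((((1 - 12 * |β'|) * Real.log 108 / (2 * ((1300 + 4 * Real.sqrt 2) * |β'| + (1 - 12 * |β'|)))) / 2) / 2)))) := by
    intro q
    simp only [hb]
    rw [Fintype.sum_prod_type]
    simp only [Finset.sum_const, Finset.card_univ, nsmul_eq_mul]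
    rw [← Finset.mul_sum, hplanes]
    refine mul_le_mul_of_nonneg_left ?_ (by norm_num)
    have h := sum_exp_neg_mul_torusDist_le (L := L) q.1 hκ2
    refine le_trans (le_of_eq (Finset.sum_congr rfl fun y _ => ?_)) h
    rw [torusDist_comm]
  have hsumb2 : ∀ q' : Plaquette 3 L, ∑ q : Plaquette 3 L, b q q' ≤ 3 * ((1 + 12 / (((1 - 12 * |β'|) * Real.log 108 / (2 * ((1300 + 4 * Real.sqrt 2) * |β'| + (1 - 12 * |β'|)))) / 2)) ^ 3 / (1 - Real.exp (-((((1 - 12 * |β'|) * Real.log 108 / (2 * ((1300 + 4 * Real.sqrt 2) * |β'| + (1 - 12 * |β'|)))) / 2) / 2)))) := by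
    intro q'
    simp only [hb]
    rw [Fintype.sum_prod_type]
    simp only [Finset.sum_const, Finset.card_univ, nsmul_eq_mul]
    rw [← Finset.mul_sum, hplanes]
    refine mul_le_mul_of_nonneg_left ?_ (by norm_num)
    exact sum_exp_neg_mul_torusDist_le (L := L) q'.1 hκ2
  -- (ii) the pointwise bound through the weights
  have hpt : ∀ q q' : Plaquette 3 L, |∫ x, ((fun y : (Edge 3 L × Fin 2 × Fin 2 × Bool → ℝ) => ((l₁.map (fun a : Edge 3 L × Bool => if a.2 then ((fun (ee : Edge 3 L) => Matrix.of fun (i j : Fin 2) => ((y (ee, i, j, false) : ℝ) : ℂ) + ((y (ee, i, j, true) : ℝ) : ℂ) * Complex.I) a.1)ᴴ else (fun (ee : Edge 3 L) => Matrix.of fun (i j : Fin 2) => ((y (ee, i, j, false) : ℝ) : ℂ) + ((y (ee, i, j, true) : ℝ) : ℂ) * Complex.I) a.1)).prod).trace.re) (coords x) - ∫ x, (fun y : (Edge 3 L × Fin 2 × Fin 2 × Bool → ℝ) => ((l₁.map (fun a : Edge 3 L × Bool => if a.2 then ((fun (ee : Edge 3 L) => Matrix.of fun (i j : Fin 2)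 => ((y (ee, i, j, false) : ℝ) : ℂ) + ((y (ee, i, j, true) : ℝ) : ℂ) * Complex.I) a.1)ᴴ else (fun (ee : Edge 3 L) => Matrix.of fun (i j : Fin 2) => ((y (ee, i, j, false) : ℝ) : ℂ) + ((y (ee, i, j, true) : ℝ) : ℂ) * Complex.I) a.1)).prod).trace.re) (coords x) ∂(wilsonMeasure (d := 3) (L := L) (fundamentalRep (Fin 2)) β')) * ((fun y : (Edge 3 L × Fin 2 × Fin 2 × Bool → ℝ) => (([((q.1, q.2.1.1), false), ((Literature.MathematicalPhysics.QuantumFieldTheory.Site.shift q.1 q.2.1.1, q.2.1.2), false), ((Literature.MathematicalPhysics.QuantumFieldTheory.Site.shift q.1 q.2.1.2, q.2.1.1), true), ((q.1, q.2.1.2), true)].map (fun a : Edge 3 L × Bool => if a.2 then ((fun (ee : Edge 3 L) => Matrix.of fun (i j : Fin 2) => ((y (ee, i, j, false) : ℝ) : ℂ) + ((y (ee, i, j, true) : ℝ) : ℂ) * Complex.I) a.1)ᴴ else (fun (ee : Edge 3 L) => Matrix.of fun (i j : Fin 2) => ((y (ee, i, j, false) : ℝ) : ℂ) + ((y (ee,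 i, j, true) : ℝ) : ℂ) * Complex.I) a.1)).prod).trace.re) (coords x) - ∫ x, (fun y : (Edge 3 L × Fin 2 × Fin 2 × Bool → ℝ) => (([((q.1, q.2.1.1), false), ((Literature.MathematicalPhysics.QuantumFieldTheory.Site.shift q.1 q.2.1.1, q.2.1.2), false), ((Literature.MathematicalPhysics.QuantumFieldTheory.Site.shift q.1 q.2.1.2, q.2.1.1), true), ((q.1, q.2.1.2), true)].map (fun a : Edge 3 L × Bool => if a.2 then ((fun (ee : Edge 3 L) => Matrix.of fun (i j : Fin 2) => ((y (ee, i, j, false) : ℝ) : ℂ) + ((y (ee, i, j, true) : ℝ) : ℂ) * Complex.I) a.1)ᴴ else (fun (ee : Edge 3 L) => Matrix.of fun (i j : Fin 2) => ((y (ee, i, j, false) : ℝ) : ℂ) + ((y (ee, i, j, true) : ℝ) : ℂ) * Complex.I) a.1)).prod).trace.re) (coords x) ∂(wilsonMeasure (d := 3) (L := L) (fundamentalRep (Fin 2)) β')) * ((fun y : (Edge 3 L × Fin 2 × Fin 2 × Bool → ℝ) => (([((q'.1, q'.2.1.1), false), ((Literature.MathematicalPhysics.QuantumFieldTheory.Site.shift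 q'.1 q'.2.1.1, q'.2.1.2), false), ((Literature.MathematicalPhysics.QuantumFieldTheory.Site.shift q'.1 q'.2.1.2, q'.2.1.1), true), ((q'.1, q'.2.1.2), true)].map (fun a : Edge 3 L × Bool => if a.2 then ((fun (ee : Edge 3 L) => Matrix.of fun (i j : Fin 2) => ((y (ee, i, j, false) : ℝ) : ℂ) + ((y (ee, i, j, true) : ℝ) : ℂ) * Complex.I) a.1)ᴴ else (fun (ee : Edge 3 L) => Matrix.of fun (i j : Fin 2) => ((y (ee, i, j, false) : ℝ) : ℂ) + ((y (ee, i, j, true) : ℝ) : ℂ) * Complex.I) a.1)).prod).trace.re) (coords x) - ∫ x, (fun y : (Edge 3 L × Fin 2 × Fin 2 × Bool → ℝ) => (([((q'.1, q'.2.1.1), false), ((Literature.MathematicalPhysics.QuantumFieldTheory.Site.shift q'.1 q'.2.1.1, q'.2.1.2), false), ((Literature.MathematicalPhysics.QuantumFieldTheory.Site.shift q'.1 q'.2.1.2, q'.2.1.1), true), ((q'.1, q'.2.1.2), true)].map (fun a : Edge 3 L × Bool => if a.2 then ((fun (ee : Edge 3 L) => Matrix.of fun (i j : Fin 2) => ((y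 (ee, i, j, false) : ℝ) : ℂ) + ((y (ee, i, j, true) : ℝ) : ℂ) * Complex.I) a.1)ᴴ else (fun (ee : Edge 3 L) => Matrix.of fun (i j : Fin 2) => ((y (ee, i, j, false) : ℝ) : ℂ) + ((y (ee, i, j, true) : ℝ) : ℂ) * Complex.I) a.1)).prod).trace.re) (coords x) ∂(wilsonMeasure (d := 3) (L := L) (fundamentalRep (Fin 2)) β')) ∂(wilsonMeasure (d := 3) (L := L) (fundamentalRep (Fin 2)) β')| ≤ (4096 * Real.pi ^ 2 * ((l₁.length : ℝ) ^ 2 + 8) * (2 / (1 - 12 * |β'|)) * Real.exp (2 * ((1 - 12 * |β'|) * Real.log 108 / (2 * ((1300 + 4 * Real.sqrt 2) * |β'| + (1 - 12 * |β'|)))))) * (a q * a q' + a q * b q q' + a q' * b q q') := by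
    intro q q'
    obtain ⟨e₁, he₁, hmin₁⟩ := Finset.exists_min_image S₁ (fun e' : Edge 3 L => (Finset.univ.sup fun i : Fin 3 => ((e'.1 i - q.1 i).valMinAbs).natAbs)) hS₁ne
    obtain ⟨e₂, he₂, hmin₂⟩ := Finset.exists_min_image S₁ (fun e' : Edge 3 L => (Finset.univ.sup fun i : Fin 3 => ((e'.1 i - q'.1 i).valMinAbs).natAbs)) hS₁ne
    have hc3 : (Finset.univ.sup fun i : Fin 3 => ((q.1 i - q'.1 i).valMinAbs).natAbs) ≤ (Finset.univ.sup fun i : Fin 3 => ((q'.1 i - q.1 i).valMinAbs).natAbs) := le_of_eq (torusDist_comm q.1 q'.1).symm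
    have T23 : |∫ x, ((fun y : (Edge 3 L × Fin 2 × Fin 2 × Bool → ℝ) => ((l₁.map (fun a : Edge 3 L × Bool => if a.2 then ((fun (ee : Edge 3 L) => Matrix.of fun (i j : Fin 2) => ((y (ee, i, j, false) : ℝ) : ℂ) + ((y (ee, i, j, true) : ℝ) : ℂ) * Complex.I) a.1)ᴴ else (fun (ee : Edge 3 L) => Matrix.of fun (i j : Fin 2) => ((y (ee, i, j, false) : ℝ) : ℂ) + ((y (ee, i, j, true) : ℝ) : ℂ) * Complex.I) a.1)).prod).trace.re) (coords x) - ∫ x, (fun y : (Edge 3 L × Fin 2 × Fin 2 × Bool → ℝ) => ((l₁.map (fun a : Edge 3 L × Bool => if a.2 then ((fun (ee : Edge 3 L) => Matrix.of fun (i j : Fin 2) => ((y (ee, i, j, false) : ℝ) : ℂ) + ((y (ee, i, j, true) : ℝ) : ℂ) * Complex.I) a.1)ᴴ else (fun (ee : Edge 3 L) => Matrix.of fun (i j : Fin 2) => ((y (ee, i, j, false) : ℝ) : ℂ) + ((y (ee, i, j, true) : ℝ) : ℂ) * Complex.I) a.1)).prod).trace.re) (coords x) ∂(wilsonMeasure (d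 := 3) (L := L) (fundamentalRep (Fin 2)) β')) * ((fun y : (Edge 3 L × Fin 2 × Fin 2 × Bool → ℝ) => (([((q.1, q.2.1.1), false), ((Literature.MathematicalPhysics.QuantumFieldTheory.Site.shift q.1 q.2.1.1, q.2.1.2), false), ((Literature.MathematicalPhysics.QuantumFieldTheory.Site.shift q.1 q.2.1.2, q.2.1.1), true), ((q.1, q.2.1.2), true)].map (fun a : Edge 3 L × Bool => if a.2 then ((fun (ee : Edge 3 L) => Matrix.of fun (i j : Fin 2) => ((y (ee, i, j, false) : ℝ) : ℂ) + ((y (ee, i, j, true) : ℝ) : ℂ) * Complex.I) a.1)ᴴ else (fun (ee : Edge 3 L) => Matrix.of fun (i j : Fin 2) => ((y (ee, i, j, false) : ℝ) : ℂ) + ((y (ee, i, j, true) : ℝ) : ℂ) * Complex.I) a.1)).prod).trace.re) (coords x) - ∫ x, (fun y : (Edge 3 L × Fin 2 × Fin 2 × Bool → ℝ) => (([((q.1, q.2.1.1), false), ((Literature.MathematicalPhysics.QuantumFieldTheory.Site.shift q.1 q.2.1.1, q.2.1.2), false), ((Literature.MathematicalPhysics.QuantumFieldTheory.Site.shift q.1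 q.2.1.2, q.2.1.1), true), ((q.1, q.2.1.2), true)].map (fun a : Edge 3 L × Bool => if a.2 then ((fun (ee : Edge 3 L) => Matrix.of fun (i j : Fin 2) => ((y (ee, i, j, false) : ℝ) : ℂ) + ((y (ee, i, j, true) : ℝ) : ℂ) * Complex.I) a.1)ᴴ else (fun (ee : Edge 3 L) => Matrix.of fun (i j : Fin 2) => ((y (ee, i, j, false) : ℝ) : ℂ) + ((y (ee, i, j, true) : ℝ) : ℂ) * Complex.I) a.1)).prod).trace.re) (coords x) ∂(wilsonMeasure (d := 3) (L := L) (fundamentalRep (Fin 2)) β')) * ((fun y : (Edge 3 L × Fin 2 × Fin 2 × Bool → ℝ) => (([((q'.1, q'.2.1.1), false), ((Literature.MathematicalPhysics.QuantumFieldTheory.Site.shift q'.1 q'.2.1.1, q'.2.1.2), false), ((Literature.MathematicalPhysics.QuantumFieldTheory.Site.shift q'.1 q'.2.1.2, q'.2.1.1), true), ((q'.1, q'.2.1.2), true)].map (fun a : Edge 3 L × Bool => if a.2 then ((fun (ee : Edge 3 L) => Matrix.of fun (i j : Fin 2) => ((y (ee, i, j, false) : ℝ) : ℂ) + ((y (ee,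 i, j, true) : ℝ) : ℂ) * Complex.I) a.1)ᴴ else (fun (ee : Edge 3 L) => Matrix.of fun (i j : Fin 2) => ((y (ee, i, j, false) : ℝ) : ℂ) + ((y (ee, i, j, true) : ℝ) : ℂ) * Complex.I) a.1)).prod).trace.re) (coords x) - ∫ x, (fun y : (Edge 3 L × Fin 2 × Fin 2 × Bool → ℝ) => (([((q'.1, q'.2.1.1), false), ((Literature.MathematicalPhysics.QuantumFieldTheory.Site.shift q'.1 q'.2.1.1, q'.2.1.2), false), ((Literature.MathematicalPhysics.QuantumFieldTheory.Site.shift q'.1 q'.2.1.2, q'.2.1.1), true), ((q'.1, q'.2.1.2), true)].map (fun a : Edge 3 L × Bool => if a.2 then ((fun (ee : Edge 3 L) => Matrix.of fun (i j : Fin 2) => ((y (ee, i, j, false) : ℝ) : ℂ) + ((y (ee, i, j, true) : ℝ) : ℂ) * Complex.I) a.1)ᴴ else (fun (ee : Edge 3 L) => Matrix.of fun (i j : Fin 2) => ((y (ee, i, j, false) : ℝ) : ℂ) + ((y (ee, i, j, true) : ℝ) : ℂ) * Complex.I) a.1)).prod).trace.re) (coords x) ∂(wilsonMeasure (d := 3)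 (L := L) (fundamentalRep (Fin 2)) β')) ∂(wilsonMeasure (d := 3) (L := L) (fundamentalRep (Fin 2)) β')| ≤ (4096 * Real.pi ^ 2 * ((l₁.length : ℝ) ^ 2 + 8) * (2 / (1 - 12 * |β'|)) * Real.exp (2 * ((1 - 12 * |β'|) * Real.log 108 / (2 * ((1300 + 4 * Real.sqrt 2) * |β'| + (1 - 12 * |β'|)))))) * Real.exp (-(((1 - 12 * |β'|) * Real.log 108 / (2 * ((1300 + 4 * Real.sqrt 2) * |β'| + (1 - 12 * |β'|)))) * (min ((Finset.univ.sup fun i : Fin 3 => ((e₂.1 i - q'.1 i).valMinAbs).natAbs)) ((Finset.univ.sup fun i : Fin 3 => ((q.1 i - q'.1 i).valMinAbs).natAbs)) : ℕ))) :=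
      threePoint_isolate_right L β' hβ l₁ q q' _ (fun e' he' => (Nat.min_le_left _ _).trans (hmin₂ e' he')) (Nat.min_le_right _ _)
    have T12 : |∫ x, ((fun y : (Edge 3 L × Fin 2 × Fin 2 × Bool → ℝ) => ((l₁.map (fun a : Edge 3 L × Bool => if a.2 then ((fun (ee : Edge 3 L) => Matrix.of fun (i j : Fin 2) => ((y (ee, i, j, false) : ℝ) : ℂ) + ((y (ee, i, j, true) : ℝ) : ℂ) * Complex.I) a.1)ᴴ else (fun (ee : Edge 3 L) => Matrix.of fun (i j : Fin 2) => ((y (ee, i, j, false) : ℝ) : ℂ) + ((y (ee, i, j, true) : ℝ) : ℂ) * Complex.I) a.1)).prod).trace.re) (coords x) - ∫ x, (fun y : (Edge 3 L × Fin 2 × Fin 2 × Bool → ℝ) => ((l₁.map (fun a : Edge 3 L × Bool => if a.2 then ((fun (ee : Edge 3 L) => Matrix.of fun (i j : Fin 2) => ((y (ee, i, j, false) : ℝ) : ℂ) + ((y (ee, i, j, true) : ℝ) : ℂ) * Complex.I) a.1)ᴴ else (fun (ee : Edge 3 L) => Matrix.of fun (i j : Fin 2) => ((y (ee, i, j, false)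 : ℝ) : ℂ) + ((y (ee, i, j, true) : ℝ) : ℂ) * Complex.I) a.1)).prod).trace.re) (coords x) ∂(wilsonMeasure (d := 3) (L := L) (fundamentalRep (Fin 2)) β')) * ((fun y : (Edge 3 L × Fin 2 × Fin 2 × Bool → ℝ) => (([((q.1, q.2.1.1), false), ((Literature.MathematicalPhysics.QuantumFieldTheory.Site.shift q.1 q.2.1.1, q.2.1.2), false), ((Literature.MathematicalPhysics.QuantumFieldTheory.Site.shift q.1 q.2.1.2, q.2.1.1), true), ((q.1, q.2.1.2), true)].map (fun a : Edge 3 L × Bool => if a.2 then ((fun (ee : Edge 3 L) => Matrix.of fun (i j : Fin 2) => ((y (ee, i, j, false) : ℝ) : ℂ) + ((y (ee, i, j, true) : ℝ) : ℂ) * Complex.I) a.1)ᴴ else (fun (ee : Edge 3 L) => Matrix.of fun (i j : Fin 2) => ((y (ee, i, j, false) : ℝ) : ℂ) + ((y (ee, i, j, true) : ℝ) : ℂ) * Complex.I) a.1)).prod).trace.re) (coords x) - ∫ x, (fun y : (Edge 3 L × Fin 2 × Fin 2 × Bool → ℝ) => (([((q.1, q.2.1.1), false), ((Literature.MathematicalPhysics.QuantumFieldTheory.Site.shift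 q.1 q.2.1.1, q.2.1.2), false), ((Literature.MathematicalPhysics.QuantumFieldTheory.Site.shift q.1 q.2.1.2, q.2.1.1), true), ((q.1, q.2.1.2), true)].map (fun a : Edge 3 L × Bool => if a.2 then ((fun (ee : Edge 3 L) => Matrix.of fun (i j : Fin 2) => ((y (ee, i, j, false) : ℝ) : ℂ) + ((y (ee, i, j, true) : ℝ) : ℂ) * Complex.I) a.1)ᴴ else (fun (ee : Edge 3 L) => Matrix.of fun (i j : Fin 2) => ((y (ee, i, j, false) : ℝ) : ℂ) + ((y (ee, i, j, true) : ℝ) : ℂ) * Complex.I) a.1)).prod).trace.re) (coords x) ∂(wilsonMeasure (d := 3) (L := L) (fundamentalRep (Fin 2)) β')) * ((fun y : (Edge 3 L × Fin 2 × Fin 2 × Bool → ℝ) => (([((q'.1, q'.2.1.1), false), ((Literature.MathematicalPhysics.QuantumFieldTheory.Site.shift q'.1 q'.2.1.1, q'.2.1.2), false), ((Literature.MathematicalPhysics.QuantumFieldTheory.Site.shift q'.1 q'.2.1.2, q'.2.1.1), true), ((q'.1, q'.2.1.2), true)].map (fun a : Edge 3 L × Bool => if a.2 then ((fun (ee : Edge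 3 L) => Matrix.of fun (i j : Fin 2) => ((y (ee, i, j, false) : ℝ) : ℂ) + ((y (ee, i, j, true) : ℝ) : ℂ) * Complex.I) a.1)ᴴ else (fun (ee : Edge 3 L) => Matrix.of fun (i j : Fin 2) => ((y (ee, i, j, false) : ℝ) : ℂ) + ((y (ee, i, j, true) : ℝ) : ℂ) * Complex.I) a.1)).prod).trace.re) (coords x) - ∫ x, (fun y : (Edge 3 L × Fin 2 × Fin 2 × Bool → ℝ) => (([((q'.1, q'.2.1.1), false), ((Literature.MathematicalPhysics.QuantumFieldTheory.Site.shift q'.1 q'.2.1.1, q'.2.1.2), false), ((Literature.MathematicalPhysics.QuantumFieldTheory.Site.shift q'.1 q'.2.1.2, q'.2.1.1), true), ((q'.1, q'.2.1.2), true)].map (fun a : Edge 3 L × Bool => if a.2 then ((fun (ee : Edge 3 L) => Matrix.of fun (i j : Fin 2) => ((y (ee, i, j, false) : ℝ) : ℂ) + ((y (ee, i, j, true) : ℝ) : ℂ) * Complex.I) a.1)ᴴ else (fun (ee : Edge 3 L) => Matrix.of fun (i j : Fin 2) => ((y (ee, i, j, false) : ℝ) : ℂ) + ((y (ee, i, j,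 true) : ℝ) : ℂ) * Complex.I) a.1)).prod).trace.re) (coords x) ∂(wilsonMeasure (d := 3) (L := L) (fundamentalRep (Fin 2)) β')) ∂(wilsonMeasure (d := 3) (L := L) (fundamentalRep (Fin 2)) β')| ≤ (4096 * Real.pi ^ 2 * ((l₁.length : ℝ) ^ 2 + 8) * (2 / (1 - 12 * |β'|)) * Real.exp (2 * ((1 - 12 * |β'|) * Real.log 108 / (2 * ((1300 + 4 * Real.sqrt 2) * |β'| + (1 - 12 * |β'|)))))) * Real.exp (-(((1 - 12 * |β'|) * Real.log 108 / (2 * ((1300 + 4 * Real.sqrt 2) * |β'| + (1 - 12 * |β'|)))) * (min ((Finset.univ.sup fun i : Fin 3 => ((e₁.1 i - q.1 i).valMinAbs).natAbs)) ((Finset.univ.sup fun i : Fin 3 => ((e₂.1 i - q'.1 i).valMinAbs).natAbs)) : ℕ))) :=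
      threePoint_isolate_loop L β' hβ l₁ q q' _ (fun e he => (Nat.min_le_left _ _).trans (hmin₁ e he)) (fun e he => (Nat.min_le_right _ _).trans (hmin₂ e he))
    have T13' : |∫ x, ((fun y : (Edge 3 L × Fin 2 × Fin 2 × Bool → ℝ) => ((l₁.map (fun a : Edge 3 L × Bool => if a.2 then ((fun (ee : Edge 3 L) => Matrix.of fun (i j : Fin 2) => ((y (ee, i, j, false) : ℝ) : ℂ) + ((y (ee, i, j, true) : ℝ) : ℂ) * Complex.I) a.1)ᴴ else (fun (ee : Edge 3 L) => Matrix.of fun (i j : Fin 2) => ((y (ee, i, j, false) : ℝ) : ℂ) + ((y (ee, i, j, true) : ℝ) : ℂ) * Complex.I) a.1)).prod).trace.re) (coords x) - ∫ x, (fun y : (Edge 3 L × Fin 2 × Fin 2 × Bool → ℝ) => ((l₁.map (fun a : Edge 3 L × Bool => if a.2 then ((fun (ee : Edge 3 L) => Matrix.of fun (i j : Fin 2) => ((y (ee, i, j, false) : ℝ) : ℂ) + ((y (ee, i, j, true) : ℝ) : ℂ) * Complex.I) a.1)ᴴ else (fun (ee : Edge 3 L) => Matrix.of fun (i j : Fin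 2) => ((y (ee, i, j, false) : ℝ) : ℂ) + ((y (ee, i, j, true) : ℝ) : ℂ) * Complex.I) a.1)).prod).trace.re) (coords x) ∂(wilsonMeasure (d := 3) (L := L) (fundamentalRep (Fin 2)) β')) * ((fun y : (Edge 3 L × Fin 2 × Fin 2 × Bool → ℝ) => (([((q'.1, q'.2.1.1), false), ((Literature.MathematicalPhysics.QuantumFieldTheory.Site.shift q'.1 q'.2.1.1, q'.2.1.2), false), ((Literature.MathematicalPhysics.QuantumFieldTheory.Site.shift q'.1 q'.2.1.2, q'.2.1.1), true), ((q'.1, q'.2.1.2), true)].map (fun a : Edge 3 L × Bool => if a.2 then ((fun (ee : Edge 3 L) => Matrix.of fun (i j : Fin 2) => ((y (ee, i, j, false) : ℝ) : ℂ) + ((y (ee, i, j, true) : ℝ) : ℂ) * Complex.I) a.1)ᴴ else (fun (ee : Edge 3 L) => Matrix.of fun (i j : Fin 2) => ((y (ee, i, j, false) : ℝ) : ℂ) + ((y (ee, i, j, true) : ℝ) : ℂ) * Complex.I) a.1)).prod).trace.re) (coords x) - ∫ x, (fun y : (Edge 3 L × Fin 2 × Fin 2 × Bool → ℝ) => (([((q'.1,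 q'.2.1.1), false), ((Literature.MathematicalPhysics.QuantumFieldTheory.Site.shift q'.1 q'.2.1.1, q'.2.1.2), false), ((Literature.MathematicalPhysics.QuantumFieldTheory.Site.shift q'.1 q'.2.1.2, q'.2.1.1), true), ((q'.1, q'.2.1.2), true)].map (fun a : Edge 3 L × Bool => if a.2 then ((fun (ee : Edge 3 L) => Matrix.of fun (i j : Fin 2) => ((y (ee, i, j, false) : ℝ) : ℂ) + ((y (ee, i, j, true) : ℝ) : ℂ) * Complex.I) a.1)ᴴ else (fun (ee : Edge 3 L) => Matrix.of fun (i j : Fin 2) => ((y (ee, i, j, false) : ℝ) : ℂ) + ((y (ee, i, j, true) : ℝ) : ℂ) * Complex.I) a.1)).prod).trace.re) (coords x) ∂(wilsonMeasure (d := 3) (L := L) (fundamentalRep (Fin 2)) β')) * ((fun y : (Edge 3 L × Fin 2 × Fin 2 × Bool → ℝ) => (([((q.1, q.2.1.1), false), ((Literature.MathematicalPhysics.QuantumFieldTheory.Site.shift q.1 q.2.1.1, q.2.1.2), false), ((Literature.MathematicalPhysics.QuantumFieldTheory.Site.shift q.1 q.2.1.2, q.2.1.1), true), ((q.1, q.2.1.2),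 true)].map (fun a : Edge 3 L × Bool => if a.2 then ((fun (ee : Edge 3 L) => Matrix.of fun (i j : Fin 2) => ((y (ee, i, j, false) : ℝ) : ℂ) + ((y (ee, i, j, true) : ℝ) : ℂ) * Complex.I) a.1)ᴴ else (fun (ee : Edge 3 L) => Matrix.of fun (i j : Fin 2) => ((y (ee, i, j, false) : ℝ) : ℂ) + ((y (ee, i, j, true) : ℝ) : ℂ) * Complex.I) a.1)).prod).trace.re) (coords x) - ∫ x, (fun y : (Edge 3 L × Fin 2 × Fin 2 × Bool → ℝ) => (([((q.1, q.2.1.1), false), ((Literature.MathematicalPhysics.QuantumFieldTheory.Site.shift q.1 q.2.1.1, q.2.1.2), false), ((Literature.MathematicalPhysics.QuantumFieldTheory.Site.shift q.1 q.2.1.2, q.2.1.1), true), ((q.1, q.2.1.2), true)].map (fun a : Edge 3 L × Bool => if a.2 then ((fun (ee : Edge 3 L) => Matrix.of fun (i j : Fin 2) => ((y (ee, i, j, false) : ℝ) : ℂ) + ((y (ee, i, j, true) : ℝ) : ℂ) * Complex.I) a.1)ᴴ else (fun (ee : Edge 3 L) => Matrix.of fun (i j : Fin 2) => ((y (ee,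 i, j, false) : ℝ) : ℂ) + ((y (ee, i, j, true) : ℝ) : ℂ) * Complex.I) a.1)).prod).trace.re) (coords x) ∂(wilsonMeasure (d := 3) (L := L) (fundamentalRep (Fin 2)) β')) ∂(wilsonMeasure (d := 3) (L := L) (fundamentalRep (Fin 2)) β')| ≤ (4096 * Real.pi ^ 2 * ((l₁.length : ℝ) ^ 2 + 8) * (2 / (1 - 12 * |β'|)) * Real.exp (2 * ((1 - 12 * |β'|) * Real.log 108 / (2 * ((1300 + 4 * Real.sqrt 2) * |β'| + (1 - 12 * |β'|)))))) * Real.exp (-(((1 - 12 * |β'|) * Real.log 108 / (2 * ((1300 + 4 * Real.sqrt 2) * |β'| + (1 - 12 * |β'|)))) * (min ((Finset.univ.sup fun i : Fin 3 => ((e₁.1 i - q.1 i).valMinAbs).natAbs)) ((Finset.univ.sup fun i : Fin 3 => ((q.1 i - q'.1 i).valMinAbs).natAbs)) : ℕ))) :=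
      threePoint_isolate_right L β' hβ l₁ q' q _ (fun e' he' => (Nat.min_le_left _ _).trans (hmin₁ e' he')) ((Nat.min_le_right _ _).trans hc3)
    have hsym : ∫ x, ((fun y : (Edge 3 L × Fin 2 × Fin 2 × Bool → ℝ) => ((l₁.map (fun a : Edge 3 L × Bool => if a.2 then ((fun (ee : Edge 3 L) => Matrix.of fun (i j : Fin 2) => ((y (ee, i, j, false) : ℝ) : ℂ) + ((y (ee, i, j, true) : ℝ) : ℂ) * Complex.I) a.1)ᴴ else (fun (ee : Edge 3 L) => Matrix.of fun (i j : Fin 2) => ((y (ee, i, j, false) : ℝ) : ℂ) + ((y (ee, i, j, true) : ℝ) : ℂ) * Complex.I) a.1)).prod).trace.re) (coords x) - ∫ x, (fun y : (Edge 3 L × Fin 2 × Fin 2 × Bool → ℝ) => ((l₁.map (fun a : Edge 3 L × Bool => if a.2 then ((fun (ee : Edge 3 L) => Matrix.of fun (i j : Fin 2) => ((y (ee, i, j, false) : ℝ) : ℂ) + ((y (ee, i, j, true) : ℝ) : ℂ) * Complex.I) a.1)ᴴ else (fun (ee : Edge 3 L) => Matrix.of fun (i j : Fin 2) => ((y (ee,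 i, j, false) : ℝ) : ℂ) + ((y (ee, i, j, true) : ℝ) : ℂ) * Complex.I) a.1)).prod).trace.re) (coords x) ∂(wilsonMeasure (d := 3) (L := L) (fundamentalRep (Fin 2)) β')) * ((fun y : (Edge 3 L × Fin 2 × Fin 2 × Bool → ℝ) => (([((q'.1, q'.2.1.1), false), ((Literature.MathematicalPhysics.QuantumFieldTheory.Site.shift q'.1 q'.2.1.1, q'.2.1.2), false), ((Literature.MathematicalPhysics.QuantumFieldTheory.Site.shift q'.1 q'.2.1.2, q'.2.1.1), true), ((q'.1, q'.2.1.2), true)].map (fun a : Edge 3 L × Bool => if a.2 then ((fun (ee : Edge 3 L) => Matrix.of fun (i j : Fin 2) => ((y (ee, i, j, false) : ℝ) : ℂ) + ((y (ee, i, j, true) : ℝ) : ℂ) * Complex.I) a.1)ᴴ else (fun (ee : Edge 3 L) => Matrix.of fun (i j : Fin 2) => ((y (ee, i, j, false) : ℝ) : ℂ) + ((y (ee, i, j, true) : ℝ) : ℂ) * Complex.I) a.1)).prod).trace.re) (coords x) - ∫ x, (fun y : (Edge 3 L × Fin 2 × Fin 2 × Bool → ℝ) => (([((q'.1, q'.2.1.1),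 false), ((Literature.MathematicalPhysics.QuantumFieldTheory.Site.shift q'.1 q'.2.1.1, q'.2.1.2), false), ((Literature.MathematicalPhysics.QuantumFieldTheory.Site.shift q'.1 q'.2.1.2, q'.2.1.1), true), ((q'.1, q'.2.1.2), true)].map (fun a : Edge 3 L × Bool => if a.2 then ((fun (ee : Edge 3 L) => Matrix.of fun (i j : Fin 2) => ((y (ee, i, j, false) : ℝ) : ℂ) + ((y (ee, i, j, true) : ℝ) : ℂ) * Complex.I) a.1)ᴴ else (fun (ee : Edge 3 L) => Matrix.of fun (i j : Fin 2) => ((y (ee, i, j, false) : ℝ) : ℂ) + ((y (ee, i, j, true) : ℝ) : ℂ) * Complex.I) a.1)).prod).trace.re) (coords x) ∂(wilsonMeasure (d := 3) (L := L) (fundamentalRep (Fin 2)) β')) * ((fun y : (Edge 3 L × Fin 2 × Fin 2 × Bool → ℝ) => (([((q.1, q.2.1.1), false), ((Literature.MathematicalPhysics.QuantumFieldTheory.Site.shift q.1 q.2.1.1, q.2.1.2), false), ((Literature.MathematicalPhysics.QuantumFieldTheory.Site.shift q.1 q.2.1.2, q.2.1.1), true), ((q.1, q.2.1.2), true)].map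 (fun a : Edge 3 L × Bool => if a.2 then ((fun (ee : Edge 3 L) => Matrix.of fun (i j : Fin 2) => ((y (ee, i, j, false) : ℝ) : ℂ) + ((y (ee, i, j, true) : ℝ) : ℂ) * Complex.I) a.1)ᴴ else (fun (ee : Edge 3 L) => Matrix.of fun (i j : Fin 2) => ((y (ee, i, j, false) : ℝ) : ℂ) + ((y (ee, i, j, true) : ℝ) : ℂ) * Complex.I) a.1)).prod).trace.re) (coords x) - ∫ x, (fun y : (Edge 3 L × Fin 2 × Fin 2 × Bool → ℝ) => (([((q.1, q.2.1.1), false), ((Literature.MathematicalPhysics.QuantumFieldTheory.Site.shift q.1 q.2.1.1, q.2.1.2), false), ((Literature.MathematicalPhysics.QuantumFieldTheory.Site.shift q.1 q.2.1.2, q.2.1.1), true), ((q.1, q.2.1.2), true)].map (fun a : Edge 3 L × Bool => if a.2 then ((fun (ee : Edge 3 L) => Matrix.of fun (i j : Fin 2) => ((y (ee, i, j, false) : ℝ) : ℂ) + ((y (ee, i, j, true) : ℝ) : ℂ) * Complex.I) a.1)ᴴ else (fun (ee : Edge 3 L) => Matrix.of fun (i j : Fin 2) => ((y (ee, i, j,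 false) : ℝ) : ℂ) + ((y (ee, i, j, true) : ℝ) : ℂ) * Complex.I) a.1)).prod).trace.re) (coords x) ∂(wilsonMeasure (d := 3) (L := L) (fundamentalRep (Fin 2)) β')) ∂(wilsonMeasure (d := 3) (L := L) (fundamentalRep (Fin 2)) β') = ∫ x, ((fun y : (Edge 3 L × Fin 2 × Fin 2 × Bool → ℝ) => ((l₁.map (fun a : Edge 3 L × Bool => if a.2 then ((fun (ee : Edge 3 L) => Matrix.of fun (i j : Fin 2) => ((y (ee, i, j, false) : ℝ) : ℂ) + ((y (ee, i, j, true) : ℝ) : ℂ) * Complex.I) a.1)ᴴ else (fun (ee : Edge 3 L) => Matrix.of fun (i j : Fin 2) => ((y (ee, i, j, false) : ℝ) : ℂ) + ((y (ee, i, j, true) : ℝ) : ℂ) * Complex.I) a.1)).prod).trace.re) (coords x) - ∫ x, (fun y : (Edge 3 L × Fin 2 × Fin 2 × Bool → ℝ) => ((l₁.map (fun a : Edge 3 L × Bool => if a.2 then ((fun (ee : Edge 3 L) => Matrix.of fun (i j : Fin 2) => ((y (ee, i, j, false) : ℝ) : ℂ) + ((y (ee, i, j, true) : ℝ) : ℂ)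 * Complex.I) a.1)ᴴ else (fun (ee : Edge 3 L) => Matrix.of fun (i j : Fin 2) => ((y (ee, i, j, false) : ℝ) : ℂ) + ((y (ee, i, j, true) : ℝ) : ℂ) * Complex.I) a.1)).prod).trace.re) (coords x) ∂(wilsonMeasure (d := 3) (L := L) (fundamentalRep (Fin 2)) β')) * ((fun y : (Edge 3 L × Fin 2 × Fin 2 × Bool → ℝ) => (([((q.1, q.2.1.1), false), ((Literature.MathematicalPhysics.QuantumFieldTheory.Site.shift q.1 q.2.1.1, q.2.1.2), false), ((Literature.MathematicalPhysics.QuantumFieldTheory.Site.shift q.1 q.2.1.2, q.2.1.1), true), ((q.1, q.2.1.2), true)].map (fun a : Edge 3 L × Bool => if a.2 then ((fun (ee : Edge 3 L) => Matrix.of fun (i j : Fin 2) => ((y (ee, i, j, false) : ℝ) : ℂ) + ((y (ee, i, j, true) : ℝ) : ℂ) * Complex.I) a.1)ᴴ else (fun (ee : Edge 3 L) => Matrix.of fun (i j : Fin 2) => ((y (ee, i, j, false) : ℝ) : ℂ) + ((y (ee, i, j, true) : ℝ) : ℂ) * Complex.I) a.1)).prod).trace.re) (coords x) - ∫ x, (fun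 y : (Edge 3 L × Fin 2 × Fin 2 × Bool → ℝ) => (([((q.1, q.2.1.1), false), ((Literature.MathematicalPhysics.QuantumFieldTheory.Site.shift q.1 q.2.1.1, q.2.1.2), false), ((Literature.MathematicalPhysics.QuantumFieldTheory.Site.shift q.1 q.2.1.2, q.2.1.1), true), ((q.1, q.2.1.2), true)].map (fun a : Edge 3 L × Bool => if a.2 then ((fun (ee : Edge 3 L) => Matrix.of fun (i j : Fin 2) => ((y (ee, i, j, false) : ℝ) : ℂ) + ((y (ee, i, j, true) : ℝ) : ℂ) * Complex.I) a.1)ᴴ else (fun (ee : Edge 3 L) => Matrix.of fun (i j : Fin 2) => ((y (ee, i, j, false) : ℝ) : ℂ) + ((y (ee, i, j, true) : ℝ) : ℂ) * Complex.I) a.1)).prod).trace.re) (coords x) ∂(wilsonMeasure (d := 3) (L := L) (fundamentalRep (Fin 2)) β')) * ((fun y : (Edge 3 L × Fin 2 × Fin 2 × Bool → ℝ) => (([((q'.1, q'.2.1.1), false), ((Literature.MathematicalPhysics.QuantumFieldTheory.Site.shift q'.1 q'.2.1.1, q'.2.1.2), false), ((Literature.MathematicalPhysics.QuantumFieldTheory.Site.shift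 q'.1 q'.2.1.2, q'.2.1.1), true), ((q'.1, q'.2.1.2), true)].map (fun a : Edge 3 L × Bool => if a.2 then ((fun (ee : Edge 3 L) => Matrix.of fun (i j : Fin 2) => ((y (ee, i, j, false) : ℝ) : ℂ) + ((y (ee, i, j, true) : ℝ) : ℂ) * Complex.I) a.1)ᴴ else (fun (ee : Edge 3 L) => Matrix.of fun (i j : Fin 2) => ((y (ee, i, j, false) : ℝ) : ℂ) + ((y (ee, i, j, true) : ℝ) : ℂ) * Complex.I) a.1)).prod).trace.re) (coords x) - ∫ x, (fun y : (Edge 3 L × Fin 2 × Fin 2 × Bool → ℝ) => (([((q'.1, q'.2.1.1), false), ((Literature.MathematicalPhysics.QuantumFieldTheory.Site.shift q'.1 q'.2.1.1, q'.2.1.2), false), ((Literature.MathematicalPhysics.QuantumFieldTheory.Site.shift q'.1 q'.2.1.2, q'.2.1.1), true), ((q'.1, q'.2.1.2), true)].map (fun a : Edge 3 L × Bool => if a.2 then ((fun (ee : Edge 3 L) => Matrix.of fun (i j : Fin 2) => ((y (ee, i, j, false) : ℝ) : ℂ) + ((y (ee, i, j, true) : ℝ) : ℂ) * Complex.I) a.1)ᴴ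 else (fun (ee : Edge 3 L) => Matrix.of fun (i j : Fin 2) => ((y (ee, i, j, false) : ℝ) : ℂ) + ((y (ee, i, j, true) : ℝ) : ℂ) * Complex.I) a.1)).prod).trace.re) (coords x) ∂(wilsonMeasure (d := 3) (L := L) (fundamentalRep (Fin 2)) β')) ∂(wilsonMeasure (d := 3) (L := L) (fundamentalRep (Fin 2)) β') := integral_congr_ae (ae_of_all _ fun x => by ring)
    rw [hsym] at T13'
    have hmid := le_mul_pairSum_of_three hκ.le hB0 _ _ _ T12 T13' T23
    refine hmid.trans (mul_le_mul_of_nonneg_left ?_ hB0)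
    have h1 : Real.exp (-(((1 - 12 * |β'|) * Real.log 108 / (2 * ((1300 + 4 * Real.sqrt 2) * |β'| + (1 - 12 * |β'|)))) / 2 * ((Finset.univ.sup fun i : Fin 3 => ((e₁.1 i - q.1 i).valMinAbs).natAbs) : ℕ))) ≤ a q :=
      Finset.single_le_sum (f := fun e' : Edge 3 L => Real.exp (-(((1 - 12 * |β'|) * Real.log 108 / (2 * ((1300 + 4 * Real.sqrt 2) * |β'| + (1 - 12 * |β'|)))) / 2 * ((Finset.univ.sup fun i : Fin 3 => ((e'.1 i - q.1 i).valMinAbs).natAbs) : ℕ)))) (fun e' _ => (Real.exp_pos _).le) he₁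
    have h2 : Real.exp (-(((1 - 12 * |β'|) * Real.log 108 / (2 * ((1300 + 4 * Real.sqrt 2) * |β'| + (1 - 12 * |β'|)))) / 2 * ((Finset.univ.sup fun i : Fin 3 => ((e₂.1 i - q'.1 i).valMinAbs).natAbs) : ℕ))) ≤ a q' :=
      Finset.single_le_sum (f := fun e' : Edge 3 L => Real.exp (-(((1 - 12 * |β'|) * Real.log 108 / (2 * ((1300 + 4 * Real.sqrt 2) * |β'| + (1 - 12 * |β'|)))) / 2 * ((Finset.univ.sup fun i : Fin 3 => ((e'.1 i - q'.1 i).valMinAbs).natAbs) : ℕ)))) (fun e' _ => (Real.exp_pos _).le) he₂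
    have h3 : Real.exp (-(((1 - 12 * |β'|) * Real.log 108 / (2 * ((1300 + 4 * Real.sqrt 2) * |β'| + (1 - 12 * |β'|)))) / 2 * ((Finset.univ.sup fun i : Fin 3 => ((q.1 i - q'.1 i).valMinAbs).natAbs) : ℕ))) = b q q' := rfl
    have e10 : 0 ≤ Real.exp (-(((1 - 12 * |β'|) * Real.log 108 / (2 * ((1300 + 4 * Real.sqrt 2) * |β'| + (1 - 12 * |β'|)))) / 2 * ((Finset.univ.sup fun i : Fin 3 => ((e₁.1 i - q.1 i).valMinAbs).natAbs) : ℕ))) := (Real.exp_pos _).le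
    have e20 : 0 ≤ Real.exp (-(((1 - 12 * |β'|) * Real.log 108 / (2 * ((1300 + 4 * Real.sqrt 2) * |β'| + (1 - 12 * |β'|)))) / 2 * ((Finset.univ.sup fun i : Fin 3 => ((e₂.1 i - q'.1 i).valMinAbs).natAbs) : ℕ))) := (Real.exp_pos _).le
    have e30 : 0 ≤ Real.exp (-(((1 - 12 * |β'|) * Real.log 108 / (2 * ((1300 + 4 * Real.sqrt 2) * |β'| + (1 - 12 * |β'|)))) / 2 * ((Finset.univ.sup fun i : Fin 3 => ((q.1 i - q'.1 i).valMinAbs).natAbs) : ℕ))) := (Real.exp_pos _).le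
    rw [h3]
    exact add_le_add (add_le_add (mul_le_mul h1 h2 e20 (ha0 q)) (mul_le_mul_of_nonneg_right h1 (hb0 q q')))
      (mul_le_mul_of_nonneg_right h2 (hb0 q q'))
  -- (iii) summation
  have hAA : ∑ q : Plaquette 3 L, ∑ q' : Plaquette 3 L, a q * a q' ≤ ((l₁.length : ℝ) * (3 * ((1 + 12 / (((1 - 12 * |β'|) * Real.log 108 / (2 * ((1300 + 4 * Real.sqrt 2) * |β'| + (1 - 12 * |β'|)))) / 2)) ^ 3 / (1 - Real.exp (-((((1 - 12 * |β'|) * Real.log 108 / (2 * ((1300 + 4 * Real.sqrt 2) * |β'| + (1 - 12 * |β'|)))) / 2) / 2)))))) ^ 2 := by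
    rw [← Finset.sum_mul_sum, sq]
    exact mul_le_mul hsuma hsuma (Finset.sum_nonneg fun q _ => ha0 q) (by positivity)
  have hAB : ∑ q : Plaquette 3 L, ∑ q' : Plaquette 3 L, a q * b q q' ≤ ((l₁.length : ℝ) * (3 * ((1 + 12 / (((1 - 12 * |β'|) * Real.log 108 / (2 * ((1300 + 4 * Real.sqrt 2) * |β'| + (1 - 12 * |β'|)))) / 2)) ^ 3 / (1 - Real.exp (-((((1 - 12 * |β'|) * Real.log 108 / (2 * ((1300 + 4 * Real.sqrt 2) * |β'| + (1 - 12 * |β'|)))) / 2) / 2)))))) * (3 * ((1 + 12 / (((1 - 12 * |β'|) * Real.log 108 / (2 * ((1300 + 4 * Real.sqrt 2) * |β'| + (1 - 12 * |β'|)))) / 2)) ^ 3 / (1 - Real.exp (-((((1 - 12 * |β'|) * Real.log 108 / (2 * ((1300 + 4 * Real.sqrt 2) * |β'| + (1 - 12 * |β'|)))) / 2) / 2))))) := by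
    calc ∑ q : Plaquette 3 L, ∑ q' : Plaquette 3 L, a q * b q q' = ∑ q : Plaquette 3 L, a q * ∑ q' : Plaquette 3 L, b q q' :=
          Finset.sum_congr rfl fun q _ => by rw [Finset.mul_sum]
      _ ≤ ∑ q : Plaquette 3 L, a q * (3 * ((1 + 12 / (((1 - 12 * |β'|) * Real.log 108 / (2 * ((1300 + 4 * Real.sqrt 2) * |β'| + (1 - 12 * |β'|)))) / 2)) ^ 3 / (1 - Real.exp (-((((1 - 12 * |β'|) * Real.log 108 / (2 * ((1300 + 4 * Real.sqrt 2) * |β'| + (1 - 12 * |β'|)))) / 2) / 2))))) := Finset.sum_le_sum fun q _ => mul_le_mul_of_nonneg_left (hsumb1 q) (ha0 q)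
      _ = (∑ q : Plaquette 3 L, a q) * (3 * ((1 + 12 / (((1 - 12 * |β'|) * Real.log 108 / (2 * ((1300 + 4 * Real.sqrt 2) * |β'| + (1 - 12 * |β'|)))) / 2)) ^ 3 / (1 - Real.exp (-((((1 - 12 * |β'|) * Real.log 108 / (2 * ((1300 + 4 * Real.sqrt 2) * |β'| + (1 - 12 * |β'|)))) / 2) / 2))))) := by rw [Finset.sum_mul]
      _ ≤ _ := mul_le_mul_of_nonneg_right hsuma (by positivity)
  have hBA : ∑ q : Plaquette 3 L, ∑ q' : Plaquette 3 L, a q' * b q q' ≤ ((l₁.length : ℝ) * (3 * ((1 + 12 / (((1 - 12 * |β'|) * Real.log 108 / (2 * ((1300 + 4 * Real.sqrt 2) * |β'| + (1 - 12 * |β'|)))) / 2)) ^ 3 / (1 - Real.exp (-((((1 - 12 * |β'|) * Real.log 108 / (2 * ((1300 + 4 * Real.sqrt 2) * |β'| + (1 - 12 * |β'|)))) / 2) / 2)))))) * (3 * ((1 + 12 / (((1 - 12 * |β'|) * Real.log 108 / (2 * ((1300 + 4 * Real.sqrt 2) * |β'| + (1 - 12 * |β'|)))) / 2)) ^ 3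 / (1 - Real.exp (-((((1 - 12 * |β'|) * Real.log 108 / (2 * ((1300 + 4 * Real.sqrt 2) * |β'| + (1 - 12 * |β'|)))) / 2) / 2))))) := by
    rw [Finset.sum_comm]
    calc ∑ q' : Plaquette 3 L, ∑ q : Plaquette 3 L, a q' * b q q' = ∑ q' : Plaquette 3 L, a q' * ∑ q : Plaquette 3 L, b q q' :=
          Finset.sum_congr rfl fun q' _ => by rw [Finset.mul_sum]
      _ ≤ ∑ q' : Plaquette 3 L, a q' * (3 * ((1 + 12 / (((1 - 12 * |β'|) * Real.log 108 / (2 * ((1300 + 4 * Real.sqrt 2) * |β'| + (1 - 12 * |β'|)))) / 2)) ^ 3 / (1 - Real.exp (-((((1 - 12 * |β'|) * Real.log 108 / (2 * ((1300 + 4 * Real.sqrt 2) * |β'| + (1 - 12 * |β'|)))) / 2) / 2))))) := Finset.sum_le_sum fun q' _ => mul_le_mul_of_nonneg_left (hsumb2 q') (ha0 q')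
      _ = (∑ q' : Plaquette 3 L, a q') * (3 * ((1 + 12 / (((1 - 12 * |β'|) * Real.log 108 / (2 * ((1300 + 4 * Real.sqrt 2) * |β'| + (1 - 12 * |β'|)))) / 2)) ^ 3 / (1 - Real.exp (-((((1 - 12 * |β'|) * Real.log 108 / (2 * ((1300 + 4 * Real.sqrt 2) * |β'| + (1 - 12 * |β'|)))) / 2) / 2))))) := by rw [Finset.sum_mul]
      _ ≤ _ := mul_le_mul_of_nonneg_right hsuma (by positivity)
  have hlen1 : (1 : ℝ) ≤ (l₁.length : ℝ) := by
    have h : 0 < l₁.length := List.length_pos_iff.2 hl₁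
    exact_mod_cast h
  calc ∑ q : Plaquette 3 L, ∑ q' : Plaquette 3 L, |∫ x, ((fun y : (Edge 3 L × Fin 2 × Fin 2 × Bool → ℝ) => ((l₁.map (fun a : Edge 3 L × Bool => if a.2 then ((fun (ee : Edge 3 L) => Matrix.of fun (i j : Fin 2) => ((y (ee, i, j, false) : ℝ) : ℂ) + ((y (ee, i, j, true) : ℝ) : ℂ) * Complex.I) a.1)ᴴ else (fun (ee : Edge 3 L) => Matrix.of fun (i j : Fin 2) => ((y (ee, i, j, false) : ℝ) : ℂ) + ((y (ee, i, j, true) : ℝ) : ℂ) * Complex.I) a.1)).prod).trace.re) (coords x) - ∫ x, (fun y : (Edge 3 L × Fin 2 × Fin 2 × Bool → ℝ) => ((l₁.map (fun a : Edge 3 L × Bool => if a.2 then ((fun (ee : Edge 3 L) => Matrix.of fun (i j : Fin 2) => ((y (ee, i, j, false) : ℝ) : ℂ) + ((y (ee, i, j, true) : ℝ) : ℂ) * Complex.I) a.1)ᴴ else (fun (ee : Edge 3 L) => Matrix.of fun (i j : Fin 2) => ((y (ee, i, j, false) : ℝ) : ℂ) + ((y (ee, i, j, true) : ℝ) : ℂ)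 * Complex.I) a.1)).prod).trace.re) (coords x) ∂(wilsonMeasure (d := 3) (L := L) (fundamentalRep (Fin 2)) β')) * ((fun y : (Edge 3 L × Fin 2 × Fin 2 × Bool → ℝ) => (([((q.1, q.2.1.1), false), ((Literature.MathematicalPhysics.QuantumFieldTheory.Site.shift q.1 q.2.1.1, q.2.1.2), false), ((Literature.MathematicalPhysics.QuantumFieldTheory.Site.shift q.1 q.2.1.2, q.2.1.1), true), ((q.1, q.2.1.2), true)].map (fun a : Edge 3 L × Bool => if a.2 then ((fun (ee : Edge 3 L) => Matrix.of fun (i j : Fin 2) => ((y (ee, i, j, false) : ℝ) : ℂ) + ((y (ee, i, j, true) : ℝ) : ℂ) * Complex.I) a.1)ᴴ else (fun (ee : Edge 3 L) => Matrix.of fun (i j : Fin 2) => ((y (ee, i, j, false) : ℝ) : ℂ) + ((y (ee, i, j, true) : ℝ) : ℂ) * Complex.I) a.1)).prod).trace.re) (coords x) - ∫ x, (fun y : (Edge 3 L × Fin 2 × Fin 2 × Bool → ℝ) => (([((q.1, q.2.1.1), false), ((Literature.MathematicalPhysics.QuantumFieldTheory.Site.shift q.1 q.2.1.1, q.2.1.2),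 false), ((Literature.MathematicalPhysics.QuantumFieldTheory.Site.shift q.1 q.2.1.2, q.2.1.1), true), ((q.1, q.2.1.2), true)].map (fun a : Edge 3 L × Bool => if a.2 then ((fun (ee : Edge 3 L) => Matrix.of fun (i j : Fin 2) => ((y (ee, i, j, false) : ℝ) : ℂ) + ((y (ee, i, j, true) : ℝ) : ℂ) * Complex.I) a.1)ᴴ else (fun (ee : Edge 3 L) => Matrix.of fun (i j : Fin 2) => ((y (ee, i, j, false) : ℝ) : ℂ) + ((y (ee, i, j, true) : ℝ) : ℂ) * Complex.I) a.1)).prod).trace.re) (coords x) ∂(wilsonMeasure (d := 3) (L := L) (fundamentalRep (Fin 2)) β')) * ((fun y : (Edge 3 L × Fin 2 × Fin 2 × Bool → ℝ) => (([((q'.1, q'.2.1.1), false), ((Literature.MathematicalPhysics.QuantumFieldTheory.Site.shift q'.1 q'.2.1.1, q'.2.1.2), false), ((Literature.MathematicalPhysics.QuantumFieldTheory.Site.shift q'.1 q'.2.1.2, q'.2.1.1), true), ((q'.1, q'.2.1.2), true)].map (fun a : Edge 3 L × Bool => if a.2 then ((fun (ee : Edge 3 L) => Matrix.of fun (i j :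 Fin 2) => ((y (ee, i, j, false) : ℝ) : ℂ) + ((y (ee, i, j, true) : ℝ) : ℂ) * Complex.I) a.1)ᴴ else (fun (ee : Edge 3 L) => Matrix.of fun (i j : Fin 2) => ((y (ee, i, j, false) : ℝ) : ℂ) + ((y (ee, i, j, true) : ℝ) : ℂ) * Complex.I) a.1)).prod).trace.re) (coords x) - ∫ x, (fun y : (Edge 3 L × Fin 2 × Fin 2 × Bool → ℝ) => (([((q'.1, q'.2.1.1), false), ((Literature.MathematicalPhysics.QuantumFieldTheory.Site.shift q'.1 q'.2.1.1, q'.2.1.2), false), ((Literature.MathematicalPhysics.QuantumFieldTheory.Site.shift q'.1 q'.2.1.2, q'.2.1.1), true), ((q'.1, q'.2.1.2), true)].map (fun a : Edge 3 L × Bool => if a.2 then ((fun (ee : Edge 3 L) => Matrix.of fun (i j : Fin 2) => ((y (ee, i, j, false) : ℝ) : ℂ) + ((y (ee, i, j, true) : ℝ) : ℂ) * Complex.I) a.1)ᴴ else (fun (ee : Edge 3 L) => Matrix.of fun (i j : Fin 2) => ((y (ee, i, j, false) : ℝ) : ℂ) + ((y (ee, i, j, true) : ℝ) : ℂ) * Complex.I)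 a.1)).prod).trace.re) (coords x) ∂(wilsonMeasure (d := 3) (L := L) (fundamentalRep (Fin 2)) β')) ∂(wilsonMeasure (d := 3) (L := L) (fundamentalRep (Fin 2)) β')|
      ≤ ∑ q : Plaquette 3 L, ∑ q' : Plaquette 3 L, (4096 * Real.pi ^ 2 * ((l₁.length : ℝ) ^ 2 + 8) * (2 / (1 - 12 * |β'|)) * Real.exp (2 * ((1 - 12 * |β'|) * Real.log 108 / (2 * ((1300 + 4 * Real.sqrt 2) * |β'| + (1 - 12 * |β'|)))))) * (a q * a q' + a q * b q q' + a q' * b q q') :=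
        Finset.sum_le_sum fun q _ => Finset.sum_le_sum fun q' _ => hpt q q'
    _ = (4096 * Real.pi ^ 2 * ((l₁.length : ℝ) ^ 2 + 8) * (2 / (1 - 12 * |β'|)) * Real.exp (2 * ((1 - 12 * |β'|) * Real.log 108 / (2 * ((1300 + 4 * Real.sqrt 2) * |β'| + (1 - 12 * |β'|)))))) * (∑ q : Plaquette 3 L, ∑ q' : Plaquette 3 L, a q * a q' + ∑ q : Plaquette 3 L, ∑ q' : Plaquette 3 L, a q * b q q' +
          ∑ q : Plaquette 3 L, ∑ q' : Plaquette 3 L, a q' * b q q') := by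
        simp only [Finset.mul_sum, Finset.sum_add_distrib, mul_add]
    _ ≤ (4096 * Real.pi ^ 2 * ((l₁.length : ℝ) ^ 2 + 8) * (2 / (1 - 12 * |β'|)) * Real.exp (2 * ((1 - 12 * |β'|) * Real.log 108 / (2 * ((1300 + 4 * Real.sqrt 2) * |β'| + (1 - 12 * |β'|)))))) * (((l₁.length : ℝ) * (3 * ((1 + 12 / (((1 - 12 * |β'|) * Real.log 108 / (2 * ((1300 + 4 * Real.sqrt 2) * |β'| + (1 - 12 * |β'|)))) / 2)) ^ 3 / (1 - Real.exp (-((((1 - 12 * |β'|) * Real.log 108 / (2 * ((1300 + 4 * Real.sqrt 2) * |β'| + (1 - 12 * |β'|)))) / 2) / 2)))))) ^ 2 + ((l₁.length : ℝ) * (3 * ((1 + 12 / (((1 - 12 * |β'|) * Real.log 108 / (2 * ((1300 + 4 * Real.sqrt 2) * |β'| + (1 - 12 * |β'|)))) / 2)) ^ 3 / (1 - Real.exp (-((((1 - 12 * |β'|) * Real.log 108 / (2 * ((1300 + 4 * Real.sqrt 2) * |β'| + (1 - 12 * |β'|)))) / 2) / 2)))))) * (3 * ((1 + 12 / (((1 -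 12 * |β'|) * Real.log 108 / (2 * ((1300 + 4 * Real.sqrt 2) * |β'| + (1 - 12 * |β'|)))) / 2)) ^ 3 / (1 - Real.exp (-((((1 - 12 * |β'|) * Real.log 108 / (2 * ((1300 + 4 * Real.sqrt 2) * |β'| + (1 - 12 * |β'|)))) / 2) / 2))))) + ((l₁.length : ℝ) * (3 * ((1 + 12 / (((1 - 12 * |β'|) * Real.log 108 / (2 * ((1300 + 4 * Real.sqrt 2) * |β'| + (1 - 12 * |β'|)))) / 2)) ^ 3 / (1 - Real.exp (-((((1 - 12 * |β'|) * Real.log 108 / (2 * ((1300 + 4 * Real.sqrt 2) * |β'| + (1 - 12 * |β'|)))) / 2) / 2)))))) * (3 * ((1 + 12 / (((1 - 12 * |β'|) * Real.log 108 / (2 * ((1300 + 4 * Real.sqrt 2) * |β'| + (1 - 12 * |β'|)))) / 2)) ^ 3 / (1 - Real.exp (-((((1 - 12 * |β'|) * Real.log 108 / (2 * ((1300 + 4 * Real.sqrt 2) * |β'| + (1 - 12 * |β'|)))) / 2) / 2)))))) :=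
        mul_le_mul_of_nonneg_left (add_le_add (add_le_add hAA hAB) hBA) hB0
    _ ≤ (4096 * Real.pi ^ 2 * ((l₁.length : ℝ) ^ 2 + 8) * (2 / (1 - 12 * |β'|)) * Real.exp (2 * ((1 - 12 * |β'|) * Real.log 108 / (2 * ((1300 + 4 * Real.sqrt 2) * |β'| + (1 - 12 * |β'|)))))) * (27 * (l₁.length : ℝ) ^ 2 * ((1 + 12 / (((1 - 12 * |β'|) * Real.log 108 / (2 * ((1300 + 4 * Real.sqrt 2) * |β'| + (1 - 12 * |β'|)))) / 2)) ^ 3 / (1 - Real.exp (-((((1 - 12 * |β'|) * Real.log 108 / (2 * ((1300 + 4 * Real.sqrt 2) * |β'| + (1 - 12 * |β'|)))) / 2) / 2)))) ^ 2) := by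
        refine mul_le_mul_of_nonneg_left ?_ hB0
        nlinarith [hGs0, hlen1, sq_nonneg ((1 + 12 / (((1 - 12 * |β'|) * Real.log 108 / (2 * ((1300 + 4 * Real.sqrt 2) * |β'| + (1 - 12 * |β'|)))) / 2)) ^ 3 / (1 - Real.exp (-((((1 - 12 * |β'|) * Real.log 108 / (2 * ((1300 + 4 * Real.sqrt 2) * |β'| + (1 - 12 * |β'|)))) / 2) / 2))))]
    _ = _ := by ring

end Summit.QuantumFields.YangMills.Theorems.ColdStartUniversality.LiebRobinson
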